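import Literature.Geometry.Riemannian.HeatKernelMeasures
import HarnessLib

/-!
# The heat kernel measures of a family of metrics depend only on the family on `[s, t]`
# (Bamler 2023, §3.7: the metric flow of a Ricci flow given on a compact time interval)

Continuation of `HeatEquationFamily.lean`, `HeatPropagation.lean` and `HeatKernelMeasures.lean`.
For two families `h₁`, `h₂` of Riemannian metrics on a closed manifold `M` (modelled on `ℝᵐ`),
`C^∞` on `M × ℝ`, which AGREE on the time interval `[s, t]`, the heat equations
`∂ᵣ w = Δ_{hᵢ(r)} w` on `M × [s, t]` are literally the same equation, hence:

* `IsHeatSolutionOn.congr_family` — a smooth `h₁`-heat solution on `M × [s, t]` is an `h₂`-heat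
  solution there;
* `heatValue_congr_family`, `heatValueC_congr_family` — the heat propagations `(P_{s→t} φ)(x)` of
  smooth and of continuous data coincide (existence for `h₁`, uniqueness for both families,
  Topping 2006, Thm. 3.1.1; the continuous-data propagation is the limit of the same sequence);
* `heatKernelMeasure_congr_family` — the conjugate heat kernel measures `ν_{x,t;s}`
  (Bamler 2020a, §2.3; Bamler 2023, §3.7) of the two families coincide: for `s < t` they are two
  Borel probability measures on the compact metrisable `M` with the same integrals
  `∫ φ dν = (P_{s→t} φ)(x)` of all bounded continuous `φ`
  (`ext_of_forall_integral_eq_of_IsFiniteMeasure`), for `t ≤ s` both are `δ_x`.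

Use: the metric flow of a Ricci flow `g` given on `M × [0, T]` (Bamler 2023, §3.7) is assembled
from the heat kernel measures of an arbitrary smooth extension of `g|[0,T]` to all times
(`MetricFamilyExtension.lean`); by this file the measures `ν_{x,t;s}`, `0 ≤ s ≤ t ≤ T`, do not
depend on the chosen extension. Everything is proved; no definitions, no named facts.

## References

* R. H. Bamler, *Compactness theory of the space of super Ricci flows*, Invent. Math. 233 (2023),
  1121–1277, §3.7 (the metric flow associated with a Ricci flow). [Bamler2023]
* R. H. Bamler, *Entropy and heat kernel bounds on a Ricci flow background*, arXiv:2008.07093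
  (2020), §2.3 (conjugate heat kernel measures `ν_{x,t;s}`). [Bamler2020Entropy]
* P. Topping, *Lectures on the Ricci flow*, LMS Lecture Note Series 325, CUP 2006, Thm. 3.1.1
  (weak maximum principle, uniqueness). [Topping2006]
-/

noncomputable section

open Bundle Set Function Filter Manifold MeasureTheory Measure TopologicalSpace
open scoped Manifold ContDiff Topology ENNReal NNReal

namespace Literature.Geometry.Riemannian

open Lorentzian Lorentzian.PseudoRiemannianMetric

section Congr

variable {m : ℕ} {H : Type*} [TopologicalSpace H]
  {I : ModelWithCorners ℝ (EuclideanSpace ℝ (Fin m)) H} [I.Boundaryless]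
  {M : Type*} [TopologicalSpace M] [ChartedSpace H M] [IsManifold I ∞ M]
  [T2Space M] [CompactSpace M] [SecondCountableTopology M] [MeasurableSpace M] [BorelSpace M]
  {h₁ h₂ : ℝ → PseudoRiemannianMetric I ∞ (EuclideanSpace ℝ (Fin m)) (TangentSpace I : M → Type _)}
  (hh₁ : IsContMDiffFamilyOn ∞ h₁ univ) (hR₁ : ∀ r, (h₁ r).IsRiemannian)
  (hh₂ : IsContMDiffFamilyOn ∞ h₂ univ) (hR₂ : ∀ r, (h₂ r).IsRiemannian)

omit [I.Boundaryless] [T2Space M] [CompactSpace M] [SecondCountableTopology M]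
  [MeasurableSpace M] [BorelSpace M] in
/-- **Heat solutions only see the family of metrics on `[s, t]`**: if `h₂ = h₁` on `[s, t]`,
every smooth solution of `∂ᵣ w = Δ_{h₁(r)} w` on `M × [s, t]` solves `∂ᵣ w = Δ_{h₂(r)} w` there
(the two equations coincide on `M × [s, t]`). [folklore] -/
theorem IsHeatSolutionOn.congr_family {w : ℝ → M → ℝ} {s t : ℝ}
    (hw : IsHeatSolutionOn h₁ w s t) (heq : ∀ r ∈ Icc s t, h₂ r = h₁ r) :
    IsHeatSolutionOn h₂ w s t := by
  refine ⟨hw.1, fun r hr x ↦ ?_⟩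
  rw [heq r hr]
  exact hw.2 r hr x

include hh₁ hR₁ hR₂ in
/-- **The heat propagation of smooth data only sees the family on `[s, t]`**:
`(P^{h₂}_{s→t} φ)(x) = (P^{h₁}_{s→t} φ)(x)` when `h₂ = h₁` on `[s, t]` — the `h₁`-solution from
`φ` (Friedman 1964, Ch. 3, Thm. 7) is an `h₂`-solution, and the propagation is the value of any
solution (uniqueness, Topping 2006, Thm. 3.1.1); for `t ≤ s` both sides are the junk value `φ x`.
[cite: Topping2006, Thm. 3.1.1 (p. 35)] -/
theorem heatValue_congr_family {s t : ℝ} (heq : ∀ r ∈ Icc s t, h₂ r = h₁ r) (x : M)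
    {φ : M → ℝ} (hφ : ContMDiff I 𝓘(ℝ, ℝ) ∞ φ) :
    heatValue h₂ s t x φ = heatValue h₁ s t x φ := by
  rcases le_or_gt t s with hts | hst
  · simp only [heatValue_of_le hts]
  obtain ⟨w, hw, h0⟩ := exists_isHeatSolutionOn hh₁ hR₁ hst hφ
  rw [heatValue_eq hR₂ hst (hw.congr_family heq) h0 x, heatValue_eq hR₁ hst hw h0 x]

include hh₁ hR₁ hR₂ in
/-- **The heat propagation of continuous data only sees the family on `[s, t]`**:
`(P^{h₂}_{s→t} φ)(x) = (P^{h₁}_{s→t} φ)(x)` for continuous `φ` when `h₂ = h₁` on `[s, t]` (both are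
the limit of the propagations of the same smooth approximants, which agree term by term by
`heatValue_congr_family`). [folklore] -/
theorem heatValueC_congr_family {s t : ℝ} (heq : ∀ r ∈ Icc s t, h₂ r = h₁ r) (x : M)
    {φ : M → ℝ} (hφ : Continuous φ) :
    heatValueC h₂ s t x φ = heatValueC h₁ s t x φ := by
  have e : (fun n ↦ heatValue h₂ s t x (smoothApprox I φ n)) =
      fun n ↦ heatValue h₁ s t x (smoothApprox I φ n) :=
    funext fun n ↦ heatValue_congr_family hh₁ hR₁ hR₂ heq x (contMDiff_smoothApprox hφ n)
  unfold heatValueC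
  rw [e]

/-- **The heat kernel measures only see the family of metrics on `[s, t]`**:
`ν^{h₂}_{x,t;s} = ν^{h₁}_{x,t;s}` when `h₂ = h₁` on `[s, t]`. For `s < t` the two sides are Borel
probability measures on the compact metrisable manifold `M` with the same integrals
`∫ φ dν^{hᵢ}_{x,t;s} = (P^{hᵢ}_{s→t} φ)(x)` of all bounded continuous `φ`
(`integral_heatKernelMeasure`, `heatValueC_congr_family`), hence equal; for `t ≤ s` both are `δ_x`.
In particular the metric flow of a Ricci flow given on `M × [0, T]` (Bamler 2023, §3.7), built
from the heat kernel measures of a smooth extension of the flow to all times, does not depend on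
the extension. [cite: Bamler2023, §3.7] -/
theorem heatKernelMeasure_congr_family {s t : ℝ} (heq : ∀ r ∈ Icc s t, h₂ r = h₁ r) (x : M) :
    heatKernelMeasure hh₂ hR₂ t x s = heatKernelMeasure hh₁ hR₁ t x s := by
  rcases le_or_gt t s with hts | hst
  · rw [heatKernelMeasure_of_le hh₂ hR₂ hts, heatKernelMeasure_of_le hh₁ hR₁ hts]
  haveI : MetrizableSpace M := Manifold.metrizableSpace I M
  refine ext_of_forall_integral_eq_of_IsFiniteMeasure fun f ↦ ?_
  rw [integral_heatKernelMeasure hh₂ hR₂ hst x f.continuous,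
    integral_heatKernelMeasure hh₁ hR₁ hst x f.continuous]
  exact heatValueC_congr_family hh₁ hR₁ hR₂ heq x f.continuous

end Congr

end Literature.Geometry.Riemannian

end
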